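import Mathlib
import Literature.Analysis.FunctionSpaces.DiPernaLionsCommutator
import Literature.Analysis.FunctionSpaces.SobolevGradCommutatorLocal
import Literature.Analysis.FunctionSpaces.ContDiffBumpRescale
import HarnessLib

/-!
# The DiPerna–Lions commutator lemma (`L²–W^{1,2}` local form on `ℝ³`): the named fact DISCHARGED

Analysis/FunctionSpaces theorem file (everything proved).  The named fact
`Literature.Analysis.FunctionSpaces.DiPernaLionsCommutatorL2` (file `DiPernaLionsCommutator`; DiPerna–Lions 1989,
Lemma II.1 with `p = p′ = 2`, three dimensions, fixed-shape normalised bumps `rOut = 2·rIn`) is a THEOREM of the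
tree: it is the local commutator lemma `tendsto_setLIntegral_gradCommutator'` (`SobolevGradCommutatorLocal`,
over the global form `tendsto_lintegral_gradCommutator` of `SobolevGradCommutatorLimit`, the uniform bound
`lintegral_enorm_gradCommutator_le` of `SobolevGradCommutatorL1` and the smooth case of
`SobolevGradCommutatorSmooth(Limit)`), once two bookkeeping facts are recorded:

* `contDiffBump_eq_of_rIn_rOut`, `eq_bumpRescale_of_rOut_eq_two_mul_rIn` — a Mathlib bump of shape `rOut = 2·rIn`
  IS the rescaling `bumpRescale φ₀ (s := rIn⁻¹)` of the reference bump `φ₀ = ⟨1, 2⟩` (the bump function depends on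
  `(rOut/rIn, rIn⁻¹ • x)` only), so by `integral_norm_mul_norm_gradient_normed_bumpRescale` the first gradient moments
  `∫ ‖z‖‖∇φ̃ₙ(z)‖ dz` of a fixed-shape sequence are CONSTANT (`integral_norm_mul_norm_gradient_normed_eq_of_shape`);
* `convolution_lsmul_apply_eq_integral` — `(k ⋆ f)(x) = ∫ k(x−y) f(y) dy`, to pass between the convolution spelling of
  the zeroth-order term in the named fact and the integral spelling of the lemma.

Main theorem: `DiPernaLionsCommutatorL2_holds : DiPernaLionsCommutatorL2`.
[cite: DiPernaLions1989Invent, Lemma II.1]; [cite: DiPernaLions1989, Lemma II.1]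
-/

noncomputable section

open MeasureTheory Set Filter Metric Function ContinuousLinearMap
open scoped ENNReal NNReal InnerProductSpace Topology RealInnerProductSpace ContDiff Convolution

namespace Literature.Analysis.FunctionSpaces

section Shape

variable {E : Type*} [NormedAddCommGroup E] [NormedSpace ℝ E] [HasContDiffBump E]

omit [NormedAddCommGroup E] [NormedSpace ℝ E] [HasContDiffBump E] in
/-- Two bumps with the same centre and the same radii are equal. [cite: Evans2010, Appendix C.4 (standard mollifier η_ε)] -/
theorem contDiffBump_eq_of_rIn_rOut {c : E} {f g : ContDiffBump c} (h1 : f.rIn = g.rIn) (h2 : f.rOut = g.rOut) :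
    f = g := by
  cases f; cases g; simp only at h1 h2; subst h1; subst h2; rfl

omit [NormedSpace ℝ E] [HasContDiffBump E] in
/-- **A fixed-shape bump is a rescaled reference bump**: if `rOut = 2·rIn` then
`φ = bumpRescale ⟨1, 2⟩ (s := rIn⁻¹)`. [cite: Evans2010, Appendix C.4 (standard mollifier η_ε)] -/
theorem eq_bumpRescale_of_rOut_eq_two_mul_rIn (φ : ContDiffBump (0 : E)) (h : φ.rOut = 2 * φ.rIn) :
    φ = bumpRescale (⟨1, 2, one_pos, one_lt_two⟩ : ContDiffBump (0 : E)) (inv_pos.2 φ.rIn_pos) := by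
  refine contDiffBump_eq_of_rIn_rOut ?_ ?_
  · rw [bumpRescale_rIn, one_div, inv_inv]
  · rw [bumpRescale_rOut, h, div_eq_mul_inv, inv_inv]

end Shape

section Moment

variable {E : Type*} [NormedAddCommGroup E] [InnerProductSpace ℝ E] [FiniteDimensional ℝ E]
  [MeasurableSpace E] [BorelSpace E] (μ : Measure E) [μ.IsAddHaarMeasure]

/-- **The first gradient moment of a fixed-shape mollifier does not depend on the scale**:
`rOut(φ) = 2·rIn(φ)` ⇒ `∫ ‖z‖‖∇φ̃(z)‖ dz = ∫ ‖z‖‖∇φ̃₀(z)‖ dz` for the reference bump `φ₀ = ⟨1, 2⟩`.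
[cite: DiPernaLions1989, Lemma II.1 (proof)] -/
theorem integral_norm_mul_norm_gradient_normed_eq_of_shape (φ : ContDiffBump (0 : E)) (h : φ.rOut = 2 * φ.rIn) :
    ∫ z, ‖z‖ * ‖gradient (φ.normed μ) z‖ ∂μ =
      ∫ z, ‖z‖ * ‖gradient ((⟨1, 2, one_pos, one_lt_two⟩ : ContDiffBump (0 : E)).normed μ) z‖ ∂μ := by
  rw [eq_bumpRescale_of_rOut_eq_two_mul_rIn φ h]
  exact integral_norm_mul_norm_gradient_normed_bumpRescale μ _ _

end Moment

section Convolution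

variable {E : Type*} [NormedAddCommGroup E] [MeasurableSpace E] [BorelSpace E]
  (μ : Measure E) [μ.IsAddLeftInvariant] [μ.IsNegInvariant]

/-- `(k ⋆ f)(x) = ∫ k(x − y) f(y) dy` (real-valued, `lsmul`). [cite: Evans2010, Appendix C.4 (definition of the mollification)] -/
theorem convolution_lsmul_apply_eq_integral (k f : E → ℝ) (x : E) :
    (k ⋆[lsmul ℝ ℝ, μ] f) x = ∫ y, k (x - y) * f y ∂μ := by
  rw [convolution_def]
  simp only [lsmul_apply, smul_eq_mul]
  rw [← integral_sub_left_eq_self (fun t => k t * f (x - t)) μ x]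
  simp only [sub_sub_cancel]

end Convolution

section Holds

/-- **THE DIPERNA–LIONS COMMUTATOR LEMMA HOLDS** (`L²–W^{1,2}` local form on `ℝ³`, fixed-shape bumps): the named fact
`DiPernaLionsCommutatorL2` is discharged by the tree's `tendsto_setLIntegral_gradCommutator'`.
[cite: DiPernaLions1989Invent, Lemma II.1] -/
theorem DiPernaLionsCommutatorL2_holds : DiPernaLionsCommutatorL2 := by
  intro W DW η hW hW2 hDW2 hη2 φ hφ hφ2 R
  -- the uniform first-moment bound of a fixed-shape family
  have hK : ∀ᶠ n in atTop, ∫ z, ‖z‖ * ‖gradient ((φ n).normed volume) z‖ ≤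
      ∫ z, ‖z‖ * ‖gradient ((⟨1, 2, one_pos, one_lt_two⟩ : ContDiffBump (0 : EuclideanSpace ℝ (Fin 3))).normed volume) z‖ :=
    Eventually.of_forall fun n => (integral_norm_mul_norm_gradient_normed_eq_of_shape volume (φ n) (hφ2 n)).le
  have h := tendsto_setLIntegral_gradCommutator' (volume : Measure (EuclideanSpace ℝ (Fin 3))) hη2 hW2 hW hDW2 hφ hK R
  -- the zeroth-order term in the convolution spelling
  have e : ∀ (n : ℕ) (x : EuclideanSpace ℝ (Fin 3)),
      ((φ n).normed volume ⋆[lsmul ℝ ℝ, volume] fun y =>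
          η y * LinearMap.trace ℝ (EuclideanSpace ℝ (Fin 3))
            (DW y : EuclideanSpace ℝ (Fin 3) →ₗ[ℝ] EuclideanSpace ℝ (Fin 3))) x =
        ∫ y, (φ n).normed volume (x - y) * η y *
          LinearMap.trace ℝ (EuclideanSpace ℝ (Fin 3)) (DW y : EuclideanSpace ℝ (Fin 3) →ₗ[ℝ] EuclideanSpace ℝ (Fin 3)) := by
    intro n x
    rw [convolution_lsmul_apply_eq_integral]
    exact integral_congr_ae (Eventually.of_forall fun y => (mul_assoc _ _ _).symm)
  simp_rw [e]
  exact h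

end Holds

section FixedShape

/-- **Uniform first-moment bound of a fixed-shape bump sequence** (the hypothesis `hK` of
`tendsto_setLIntegral_gradCommutator'` for sequences with `rOut = 2·rIn`): the moments are all EQUAL to the
moment of the reference bump `⟨1, 2⟩`, hence eventually bounded by it. [cite: DiPernaLions1989, Lemma II.1 (proof)] -/
theorem eventually_moment_le_of_shape {ι : Type*} {l : Filter ι}
    (φ : ι → ContDiffBump (0 : EuclideanSpace ℝ (Fin 3))) (hφ2 : ∀ i, (φ i).rOut = 2 * (φ i).rIn) :
    ∀ᶠ i in l, ∫ z, ‖z‖ * ‖gradient ((φ i).normed volume) z‖ ≤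
      ∫ z, ‖z‖ * ‖gradient ((⟨1, 2, one_pos, one_lt_two⟩ : ContDiffBump (0 : EuclideanSpace ℝ (Fin 3))).normed volume) z‖ :=
  Eventually.of_forall fun i => (integral_norm_mul_norm_gradient_normed_eq_of_shape volume (φ i) (hφ2 i)).le

end FixedShape

end Literature.Analysis.FunctionSpaces

end
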